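import Literature.Analysis.FluidPDE.ChaeAsymptoticallySelfSimilar
import Literature.Analysis.FluidPDE.NSSuitableESSEpsilonHolds
import Literature.Analysis.FluidPDE.SuitableWeakInBallTools
import HarnessLib

/-!
# Chae 2007, Theorem 1.5: the ε-regularity endgame (proofs companion, part 3)

Analysis/FluidPDE proofs file (theorems only: no definitions, no named facts), third companion of
`Literature/Analysis/FluidPDE/ChaeAsymptoticallySelfSimilar.lean` (D. Chae, Math. Ann. 338 (2007)
435–449 = arXiv:math/0604234, **Theorem 1.5**, the named fact
`chae2007_asymptoticallySelfSimilar_local`). The printed proof ends (arXiv p. 8): "We set `R = 1`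
and `√(T−t) = r` in (3.15), which becomes
`lim_{r↘0} r^{(q−3)/q} sup_{T−r²<τ<T} ‖v(·,τ)‖_{L^q(B(z,r))} = 0` (3.16). Hence, the conclusion
follows from Theorem 3.1" — Theorem 3.1 being Gustafson–Kang–Tsai's ε-regularity criterion (CMP 273
(2007), Thm 1.1) for *suitable weak solutions in a cylinder `B(z, r₁) × (t − r₁², t)`*, with a
Hölder conclusion near `(z, t)`.

In the tree the ε-regularity lemma with a Hölder conclusion **up to the top of the cylinder** is
the proved Escauriaza–Seregin–Šverák Lemma 2.2, `ess_epsilon_regularity'_holds`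
(`NSSuitableESSEpsilonHolds.lean`): a suitable pair `(U, P)` on `B₁ × (−1, 0)` (ESS Def. 2.1,
`IsESSSuitablePairOn`) with `∫∫_{Q₁} (|U|³ + |P|^{3/2}) < ε₀` has a Hölder representative on the
closed cylinder `Q̄(1/2)`. This file PROVES the bookkeeping that turns its output into the
conclusion of Chae's theorem for the classical solution `v`:

* `holderOnWith_of_zoom_ae_eq` — if the zoom `U(s, y) = R u(t₁ + R²s, x₁ + Ry)` of a field `u`
  continuous on `Q(z₁, R/2)` agrees a.e. on `Q(0, 1/2)` with an `α`-Hölder field (`α > 0`), then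
  `u` is `α`-Hölder on `Q(z₁, R/2)` (a.e.-equal continuous functions agree on open sets,
  `Measure.eqOn_open_of_ae_eq`; the inverse zoom is Lipschitz, `lipschitzWith_stAffine`);
* `epsilonRegularity_holder_of_inBall`, `chae_exists_eps_holder_of_suitableInBall` — the same
  ε-regularity statement and endgame over the Albritton–Barker class
  `IsSuitableWeakSolutionInBall` (the proof of `ess_epsilon_regularity'_holds` uses only that
  class), with the smallness as `C(r₀) + D(r₀) < ε₀` for a suitable pair `(u, p)` in the
  parabolic ball `Q((T, z), r₀)` agreeing a.e. with `v` — the shape delivered by local Leray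
  theory (`IsSuitableWeakSolutionOn.isSuitableWeakSolutionInBall`);
* `chae_exists_eps_holder_of_essSuitable` — **the endgame**: for a classical solution `v` on
  `ℝ³ × (0, T)` and `z ∈ ℝ³` there is `ε₀ > 0` such that, whenever for some `0 < r₀`, `r₀² ≤ T`
  and some pressure `P` the zoomed pair `(r₀ v(T + r₀²·, z + r₀·), P)` is ESS-suitable on
  `B₁ × (−1, 0)` with `∫∫_{Q₁} (|U|³ + |P|^{3/2}) < ε₀`, the field `v` is Hölder continuous
  (some exponent `α > 0`, product sup metric) on the parabolic cylinder
  `Q((T, z), r₀/2) = (T − r₀²/4, T) × B(z, r₀/2)` — literally the second conclusion of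
  `chae2007_asymptoticallySelfSimilar_local`.

What this isolates as the remaining input of the printed proof at this point: the suitability of
`v` near `(z, T)` *up to the blow-up time* with an `L^{3/2}` pressure (Chae assumes it: "Suppose
`v` is a suitable weak solution of (NS) in a cylinder", Thm 3.1; for the Kato-class solution of
Thm 1.5 it is local Leray theory, cf. the tree's `localEnergySolution_exists_local_of_memE2`,
`localEnergySolution_extension_of_memE2`, `local_leray_weak_strong_uniqueness`), and the passage
from (3.16) to the smallness of `∫∫_{Q₁} (|U|³ + |P|^{3/2})` at one scale.

## References

* D. Chae, Math. Ann. 338 (2007) = arXiv:math/0604234, Thm 3.1 (p. 7) and the last paragraph of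
  the proof of Thm 1.5 (p. 8) [Chae2007].
* S. Gustafson, K. Kang, T.-P. Tsai, Comm. Math. Phys. 273 (2007) 161–176, Thm 1.1
  [GustafsonKangTsai2007].
* L. Escauriaza, G. Seregin, V. Šverák, Russ. Math. Surveys 58 (2003) 211–250, Def. 2.1,
  Lemma 2.2 [EscauriazaSereginSverak2003].
-/

noncomputable section

open _root_.MeasureTheory Set Function Filter Metric TopologicalSpace
open scoped NNReal ENNReal _root_.Topology

namespace Literature.Analysis.FluidPDE

section HolderTransport

variable {R : ℝ} {u : ℝ → EuclideanSpace ℝ (Fin 3) → EuclideanSpace ℝ (Fin 3)}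

/-- **Transport of a Hölder representative back along the zoom.** Let `u` be continuous on the
parabolic ball `Q(z₁, R/2)` and suppose its zoom `U = R u ∘ Φ`, `Φ(s, y) = (t₁ + R² s, x₁ + R y)`,
agrees a.e. on `Q(0, 1/2)` with a field `w` which is `(C, α)`-Hölder on `Q(0, 1/2)`, `α > 0` (the
shape of the conclusion of the ε-regularity lemma `ess_epsilon_regularity'`). Then `u` itself is
`α`-Hölder on `Q(z₁, R/2)` (product sup metric of `ℝ × ℝ³`): `u = R⁻¹ w ∘ Φ⁻¹` a.e. on
`Q(z₁, R/2) = Φ(Q(0, 1/2))`, both sides are continuous on this open set, hence they agree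
everywhere there (`Measure.eqOn_open_of_ae_eq`), and `Φ⁻¹` is Lipschitz
(`lipschitzWith_stAffine`). [folklore] -/
theorem holderOnWith_of_zoom_ae_eq (hR : 0 < R) (z₁ : ℝ × EuclideanSpace ℝ (Fin 3))
    (hu : ContinuousOn (uncurry u) (parabolicCylinder (R / 2) z₁))
    {w : ℝ × EuclideanSpace ℝ (Fin 3) → EuclideanSpace ℝ (Fin 3)} {C α : ℝ≥0} (hα : 0 < α)
    (hw : HolderOnWith C α w (parabolicCylinder (1 / 2) (0 : ℝ × EuclideanSpace ℝ (Fin 3))))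
    (hae : uncurry (R • stPull (R ^ 2) R z₁.1 z₁.2 u)
      =ᵐ[volume.restrict (parabolicCylinder (1 / 2) (0 : ℝ × EuclideanSpace ℝ (Fin 3)))] w) :
    ∃ C' : ℝ≥0, HolderOnWith C' α (uncurry u) (parabolicCylinder (R / 2) z₁) := by
  have hR0 : R ≠ 0 := hR.ne'
  have hR2 : 0 < R ^ 2 := pow_pos hR 2
  have hR20 : R ^ 2 ≠ 0 := hR2.ne'
  -- the inverse zoom and the candidate representative
  set ψ : ℝ × EuclideanSpace ℝ (Fin 3) → ℝ × EuclideanSpace ℝ (Fin 3) :=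
    stAffine (R ^ 2)⁻¹ R⁻¹ (-((R ^ 2)⁻¹ * z₁.1)) (-(R⁻¹ • z₁.2)) with hψ
  set W : ℝ → EuclideanSpace ℝ (Fin 3) → EuclideanSpace ℝ (Fin 3) := fun s y => w (s, y) with hW
  set V : ℝ → EuclideanSpace ℝ (Fin 3) → EuclideanSpace ℝ (Fin 3) :=
    R⁻¹ • stPull (R ^ 2)⁻¹ R⁻¹ (-((R ^ 2)⁻¹ * z₁.1)) (-(R⁻¹ • z₁.2)) W with hV
  have hVapply : ∀ z : ℝ × EuclideanSpace ℝ (Fin 3), uncurry V z = R⁻¹ • w (ψ z) := by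
    rintro ⟨t, x⟩; rfl
  have hψmem : ∀ z ∈ parabolicCylinder (R / 2) z₁,
      ψ z ∈ parabolicCylinder (1 / 2) (0 : ℝ × EuclideanSpace ℝ (Fin 3)) := by
    intro z hz
    have := zoom_symm_mem_parabolicCylinder hR z₁ hz
    rwa [show R / 2 / R = 1 / 2 by field_simp] at this
  -- `u = V` a.e. on `Q(z₁, R/2)`
  have hae' : uncurry u =ᵐ[volume.restrict (parabolicCylinder (R / 2) z₁)] uncurry V := by
    refine ae_restrict_of_ae_restrict_preimage_stAffine hR2 hR z₁.1 z₁.2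
      (P := fun z => uncurry u z = uncurry V z) ?_
    rw [zoom_preimage_parabolicCylinder_half hR z₁]
    filter_upwards [hae] with q hq
    have hq' : R • u (z₁.1 + R ^ 2 * q.1) (z₁.2 + R • q.2) = W q.1 q.2 := by
      have := hq
      simp only [uncurry, smul_stPull_apply] at this
      exact this
    have e := stPull_symm_apply_stAffine hR20 hR0 z₁.1 z₁.2 W q.1 q.2
    simp only [stPull_apply] at e
    show uncurry u (stAffine (R ^ 2) R z₁.1 z₁.2 q) = uncurry V (stAffine (R ^ 2) R z₁.1 z₁.2 q)
    simp only [uncurry, stAffine_fst, stAffine_snd, hV, Pi.smul_apply, stPull_apply]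
    rw [e, ← hq', smul_smul, inv_mul_cancel₀ hR0, one_smul]
  -- continuity of `V` on `Q(z₁, R/2)` and everywhere agreement
  have hψc : Continuous ψ :=
    (lipschitzWith_stAffine (inv_nonneg.2 hR2.le) (inv_nonneg.2 hR.le) _ _).continuous
  have hVc : ContinuousOn (uncurry V) (parabolicCylinder (R / 2) z₁) := by
    have h1 : ContinuousOn (w ∘ ψ) (parabolicCylinder (R / 2) z₁) :=
      (hw.continuousOn hα).comp hψc.continuousOn hψmem
    have h2 : (uncurry V) = fun z => R⁻¹ • (w ∘ ψ) z := funext fun z => hVapply z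
    rw [h2]
    exact h1.const_smul R⁻¹
  have heq : EqOn (uncurry u) (uncurry V) (parabolicCylinder (R / 2) z₁) :=
    Measure.eqOn_open_of_ae_eq hae' (isOpen_parabolicCylinder _ _) hu hVc
  -- Hölder continuity of `V`, hence of `u`
  have hψlip : LipschitzWith (max (Real.toNNReal (R ^ 2)⁻¹) (Real.toNNReal R⁻¹)) ψ :=
    lipschitzWith_stAffine (inv_nonneg.2 hR2.le) (inv_nonneg.2 hR.le) _ _
  have hcomp1 : HolderOnWith (C * max (Real.toNNReal (R ^ 2)⁻¹) (Real.toNNReal R⁻¹) ^ (α : ℝ))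
      (α * 1) (w ∘ ψ) (parabolicCylinder (R / 2) z₁) :=
    hw.comp (hψlip.lipschitzOnWith.holderOnWith) fun z hz => hψmem z hz
  have hsmul : LipschitzWith ‖(R⁻¹ : ℝ)‖₊
      (fun x : EuclideanSpace ℝ (Fin 3) => (R⁻¹ : ℝ) • x) := lipschitzWith_smul (R⁻¹ : ℝ)
  have hcomp2 := (hsmul.lipschitzOnWith (s := univ)).holderOnWith.comp hcomp1
    (fun z _ => mem_univ _)
  rw [show (1 : ℝ≥0) * (α * 1) = α by ring] at hcomp2
  refine ⟨‖(R⁻¹ : ℝ)‖₊ * (C * max (Real.toNNReal (R ^ 2)⁻¹) (Real.toNNReal R⁻¹) ^ (α : ℝ)) ^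
    ((1 : ℝ≥0) : ℝ), fun z hz z' hz' => ?_⟩
  rw [heq hz, heq hz', hVapply, hVapply]
  exact hcomp2 z hz z' hz'

end HolderTransport

section Endgame

variable {T : ℝ} {v : ℝ → EuclideanSpace ℝ (Fin 3) → EuclideanSpace ℝ (Fin 3)}
  {π : ℝ → EuclideanSpace ℝ (Fin 3) → ℝ}

/-- **The ε-regularity step of Chae's proof, endgame** (Chae 2007, proof of Thm 1.5, last line:
"Hence, the conclusion follows from Theorem 3.1" — Gustafson–Kang–Tsai's ε-regularity; here the
tree's proved Escauriaza–Seregin–Šverák Lemma 2.2, `ess_epsilon_regularity'_holds`, whose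
conclusion is Hölder continuity up to the top of `Q(1/2)`). Let `v` be a classical solution of
Navier–Stokes (`ν = 1`, no force) on `ℝ³ × (0, T)` and `z ∈ ℝ³`. There is `ε₀ > 0` (that of
`ess_epsilon_regularity'`) such that: if for some `0 < r₀`, `r₀² ≤ T`, and some pressure `P` the
zoomed pair `(U, P)`, `U(s, y) = r₀ v(T + r₀²s, z + r₀y)`, is a suitable weak solution on the
unit cylinder `B₁ × (−1, 0)` in the sense of ESS Def. 2.1 (`IsESSSuitablePairOn`, i.e. `v` is
suitable on `Q((T, z), r₀)` *up to the final time `T`*, with an `L^{3/2}` pressure) and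
`∫∫_{Q₁} (|U|³ + |P|^{3/2}) < ε₀`, then `v` is Hölder continuous on the backward parabolic cylinder
`Q((T, z), r₀/2) = (T − r₀²/4, T) × B(z, r₀/2)` — the conclusion of
`chae2007_asymptoticallySelfSimilar_local`. (The zoom of `v` is continuous on `Q(0, 1/2)`, so the
Hölder representative given by ε-regularity coincides with it there; transport back by
`holderOnWith_of_zoom_ae_eq`.) [cite: Chae2007, proof of Thm 1.5, last paragraph (arXiv p. 8) with Thm 3.1 (p. 7)] -/
theorem chae_exists_eps_holder_of_essSuitable
    (hv : IsClassicalNSSolutionOn (Ioo 0 T) 1 0 v π) (z : EuclideanSpace ℝ (Fin 3)) :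
    ∃ ε₀ : ℝ, 0 < ε₀ ∧ ∀ (r₀ : ℝ), 0 < r₀ → r₀ ^ 2 ≤ T →
      ∀ P : ℝ → EuclideanSpace ℝ (Fin 3) → ℝ,
        IsESSSuitablePairOn unitBall (-1) 0 1 (r₀ • stPull (r₀ ^ 2) r₀ T z v) P →
        ∫⁻ q in parabolicCylinder 1 ((0 : ℝ), (0 : EuclideanSpace ℝ (Fin 3))),
            (‖(r₀ • stPull (r₀ ^ 2) r₀ T z v) q.1 q.2‖ₑ ^ 3 + ‖P q.1 q.2‖ₑ ^ (3 / 2 : ℝ)) <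
          ENNReal.ofReal ε₀ →
        ∃ r > 0, ∃ C α : ℝ≥0, 0 < α ∧ HolderOnWith C α (uncurry v) (parabolicCylinder r (T, z)) := by
  obtain ⟨ε₀, c₀, hε₀, -, H⟩ := ess_epsilon_regularity'_holds
  refine ⟨ε₀, hε₀, fun r₀ hr₀ hr₀T P hsuit hsmall => ?_⟩
  obtain ⟨w, C, α, hα, hH, hae, -⟩ := H _ P hsuit hsmall
  -- continuity of `v` on `Q((T, z), r₀/2) ⊆ (0, T) × ℝ³`
  have hsub : parabolicCylinder (r₀ / 2) (T, z) ⊆ Ioo 0 T ×ˢ (univ : Set (EuclideanSpace ℝ (Fin 3))) := by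
    intro q hq
    rw [mem_parabolicCylinder] at hq
    refine ⟨⟨?_, hq.1.2⟩, mem_univ _⟩
    have h1 : T - (r₀ / 2) ^ 2 < q.1 := hq.1.1
    nlinarith
  have hcont : ContinuousOn (uncurry v) (parabolicCylinder (r₀ / 2) (T, z)) :=
    hv.smooth_velocity.continuousOn.mono hsub
  have hH' : HolderOnWith C α w (parabolicCylinder (1 / 2) (0 : ℝ × EuclideanSpace ℝ (Fin 3))) :=
    hH.mono subset_closure
  obtain ⟨C', hC'⟩ := holderOnWith_of_zoom_ae_eq hr₀ (T, z) hcont hα hH' hae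
  exact ⟨r₀ / 2, by positivity, C', α, hα, hC'⟩

end Endgame

/-! ### The same endgame over the Albritton–Barker class `IsSuitableWeakSolutionInBall` -/

section InBall

/-- **ε-regularity with a Hölder conclusion up to the top, over the Albritton–Barker class.**
The proof of the tree's `ess_epsilon_regularity'_holds` (ESS 2003, Lemma 2.2, `k = 1`) uses its
hypothesis `IsESSSuitablePairOn unitBall (-1) 0 1 U P` only through the weaker class
`IsSuitableWeakSolutionInBall 1 0 U P` (suitable weak solution on the open unit cylinder with the
global energy, gradient and pressure classes on it; Albritton–Barker 2019, Def. 2.1); this is the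
same statement and proof over that class: there are absolute `ε₀ > 0`, `c₀ > 0` such that every
`(U, P)` of the class on `Q(0, 1)` with `∫∫_{Q₁} (|U|³ + |P|^{3/2}) < ε₀` has a representative
which is Hölder continuous on the closed cylinder `Q̄(1/2)` and bounded there by `c₀`.
[cite: EscauriazaSereginSverak2003, Lemma 2.2 (k = 1) with Remark 2.3; AlbrittonBarker2019 Def. 2.1] -/
theorem epsilonRegularity_holder_of_inBall :
    ∃ ε₀ c₀ : ℝ, 0 < ε₀ ∧ 0 < c₀ ∧
      ∀ (U : ℝ → EuclideanSpace ℝ (Fin 3) → EuclideanSpace ℝ (Fin 3))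
        (P : ℝ → EuclideanSpace ℝ (Fin 3) → ℝ),
        IsSuitableWeakSolutionInBall 1 (0 : ℝ × EuclideanSpace ℝ (Fin 3)) U P →
        ∫⁻ z in parabolicCylinder 1 ((0 : ℝ), (0 : EuclideanSpace ℝ (Fin 3))),
            (‖U z.1 z.2‖ₑ ^ 3 + ‖P z.1 z.2‖ₑ ^ (3 / 2 : ℝ)) < ENNReal.ofReal ε₀ →
        ∃ (w : ℝ × EuclideanSpace ℝ (Fin 3) → EuclideanSpace ℝ (Fin 3)) (C α : ℝ≥0), 0 < α ∧
          HolderOnWith C α w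
            (closure (parabolicCylinder (1 / 2) ((0 : ℝ), (0 : EuclideanSpace ℝ (Fin 3))))) ∧
          uncurry U =ᵐ[volume.restrict
            (parabolicCylinder (1 / 2) ((0 : ℝ), (0 : EuclideanSpace ℝ (Fin 3))))] w ∧
          ∀ z ∈ closure (parabolicCylinder (1 / 2) ((0 : ℝ), (0 : EuclideanSpace ℝ (Fin 3)))),
            ‖w z‖ < c₀ := by
  obtain ⟨εL, C₀, hεL, hC₀, H⟩ := unforced_epsilonRegularity_of_theorem15_3 RRS2016.theorem15_3_holds
  set l : ℝ := min εL (1 / (4 * C₀)) with hl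
  have hl0 : 0 < l := lt_min hεL (by positivity)
  have hlε : l ≤ εL := min_le_left _ _
  have hM : C₀ * l / (1 / 4) ≤ 1 := by
    have h4 : l ≤ 1 / (4 * C₀) := min_le_right _ _
    rw [div_le_iff₀ (by norm_num : (0 : ℝ) < 1 / 4)]
    calc C₀ * l ≤ C₀ * (1 / (4 * C₀)) := by gcongr
      _ = 1 * (1 / 4) := by field_simp
  set ε₀ : ℝ := l ^ 3 * (1 / 4) ^ 2 with hε₀
  have hε₀pos : 0 < ε₀ := by positivity
  refine ⟨ε₀, 2, hε₀pos, two_pos, ?_⟩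
  intro U P hball hsmall
  obtain ⟨G, hG, hG2⟩ := hball.2.2.1
  have hLR := hball.isLRSuitableWeakSolutionOn hG hG2 3
  -- `|U| ≤ 1` a.e. on `Q(3/4)`
  have hcentre : ∀ z₀ ∈ parabolicCylinder (3 / 4) (0 : ℝ × EuclideanSpace ℝ (Fin 3)),
      ∀ᵐ w ∂(volume.restrict (parabolicCylinder ((1 / 4) / 2) z₀)), ‖U w.1 w.2‖ ≤ 1 := by
    intro z₀ h₀
    have hsub : parabolicCylinder (1 / 4) z₀ ⊆
        parabolicCylinder 1 (0 : ℝ × EuclideanSpace ℝ (Fin 3)) :=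
      parabolicCylinder_quarter_subset_unit h₀
    have hsm : ∫⁻ w in parabolicCylinder (1 / 4) z₀,
        (‖U w.1 w.2‖ₑ ^ (3 : ℕ) + ‖P w.1 w.2‖ₑ ^ (3 / 2 : ℝ)) ≤
          ENNReal.ofReal (l ^ 3 * (1 / 4) ^ 2) :=
      (lintegral_mono_set hsub).trans hsmall.le
    have h1 := H _ 3 U P G (by norm_num) hLR z₀ (1 / 4) l (by norm_num) hsub hl0.le hlε hsm
    filter_upwards [h1] with w hw using hw.trans hM
  have hbd : ∀ᵐ w ∂(volume.restrict (parabolicCylinder (3 / 4) (0 : ℝ × EuclideanSpace ℝ (Fin 3)))),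
      ‖U w.1 w.2‖ ≤ 1 :=
    ae_parabolicCylinder_of_centres (P := fun w => ‖U w.1 w.2‖ ≤ 1) (by norm_num) hcentre
  -- the pressure bound on `Q(1)`
  have hP1 : ∫⁻ w in parabolicCylinder 1 (0 : ℝ × EuclideanSpace ℝ (Fin 3)),
      ‖P w.1 w.2‖ₑ ^ (3 / 2 : ℝ) < ∞ := by
    refine lt_of_le_of_lt (lintegral_mono fun w => ?_) (hsmall.trans ENNReal.ofReal_lt_top)
    exact le_add_self
  -- the Hölder representative on `Q(1/2)`, up to the top
  obtain ⟨V, K, α, hα, hVae, hVH⟩ :=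
    exists_holder_representative_of_bounded U P G hball.1.distributional hG hG2 hP1 hbd
  set S : Set (ℝ × EuclideanSpace ℝ (Fin 3)) :=
    parabolicCylinder (1 / 2) ((0 : ℝ), (0 : EuclideanSpace ℝ (Fin 3))) with hS
  have hSo : IsOpen S := isOpen_parabolicCylinder _ _
  have hVH' : HolderOnWith K α V S := hVH
  have hVae' : V =ᵐ[volume.restrict S] uncurry U := hVae
  have h12 : S ⊆ parabolicCylinder (3 / 4) (0 : ℝ × EuclideanSpace ℝ (Fin 3)) :=
    parabolicCylinder_zero_mono (by norm_num) (by norm_num)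
  have hVb : ∀ z ∈ S, ‖V z‖ ≤ 1 := by
    refine norm_le_of_ae_norm_le_of_continuousOn' (μ := volume) hSo (hVH'.continuousOn hα) ?_
    filter_upwards [hVae', ae_restrict_of_ae_restrict_of_subset h12 hbd] with z hz hb
    rw [hz]
    exact hb
  obtain ⟨hWH, hWF⟩ := holderOnWith_extendFrom_closure hVH' hα
  refine ⟨extendFrom S V, K, α, hα, hWH, ?_, ?_⟩
  · filter_upwards [hVae', ae_restrict_mem hSo.measurableSet] with z hz hzS
    rw [hWF hzS, hz]
  · intro z hz
    exact (norm_extendFrom_le_of_holderOnWith hVH' hα hVb hz).trans_lt one_lt_two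

variable {T : ℝ} {v : ℝ → EuclideanSpace ℝ (Fin 3) → EuclideanSpace ℝ (Fin 3)}
  {π : ℝ → EuclideanSpace ℝ (Fin 3) → ℝ}

/-- **The endgame over the Albritton–Barker class.** Let `v` be a classical solution of
Navier–Stokes (`ν = 1`, no force) on `ℝ³ × (0, T)`, `z ∈ ℝ³`. There is `ε₀ > 0` such that:
whenever some pair `(u, p)` is a suitable weak solution in the parabolic ball `Q((T, z), r₀)`,
`0 < r₀`, `r₀² ≤ T` (`IsSuitableWeakSolutionInBall`: suitable on the open cylinder *hanging from
the final time `T`*, energy class, `∇u ∈ L²`, `p ∈ L^{3/2}` on it), with `u = v` a.e. there (as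
for the local Leray solution issued from `v(0)`), and
`C(r₀) + D(r₀) = r₀⁻² ∫∫_{Q((T,z),r₀)} (|u|³ + |p|^{3/2}) < ε₀`, the field `v` is Hölder
continuous on `Q((T, z), r₀/2)` — the conclusion of `chae2007_asymptoticallySelfSimilar_local`.
(Zoom to `Q(0, 1)` — `IsSuitableWeakSolutionInBall.zoom`, `lintegral_cube_zoom`,
`lintegral_pressure_zoom` —, apply `epsilonRegularity_holder_of_inBall`, transport back by
`holderOnWith_of_zoom_ae_eq`.) [cite: Chae2007, proof of Thm 1.5, last paragraph (arXiv p. 8) with Thm 3.1 (p. 7)] -/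
theorem chae_exists_eps_holder_of_suitableInBall
    (hv : IsClassicalNSSolutionOn (Ioo 0 T) 1 0 v π) (z : EuclideanSpace ℝ (Fin 3)) :
    ∃ ε₀ : ℝ, 0 < ε₀ ∧ ∀ (r₀ : ℝ), 0 < r₀ → r₀ ^ 2 ≤ T →
      ∀ (u : ℝ → EuclideanSpace ℝ (Fin 3) → EuclideanSpace ℝ (Fin 3))
        (p : ℝ → EuclideanSpace ℝ (Fin 3) → ℝ),
        IsSuitableWeakSolutionInBall r₀ (T, z) u p →
        uncurry u =ᵐ[volume.restrict (parabolicCylinder r₀ (T, z))] uncurry v →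
        cknC r₀ (T, z) u + cknD r₀ (T, z) p < ENNReal.ofReal ε₀ →
        ∃ r > 0, ∃ C α : ℝ≥0, 0 < α ∧ HolderOnWith C α (uncurry v) (parabolicCylinder r (T, z)) := by
  obtain ⟨ε₀, c₀, hε₀, -, H⟩ := epsilonRegularity_holder_of_inBall
  refine ⟨ε₀, hε₀, fun r₀ hr₀ hr₀T u p hsuit huv hsmall => ?_⟩
  -- zoom to the unit cylinder
  have hzoom := hsuit.zoom hr₀
  have hmeasU : AEMeasurable (fun w : ℝ × EuclideanSpace ℝ (Fin 3) =>
      ‖(r₀ • stPull (r₀ ^ 2) r₀ (T, z).1 (T, z).2 u) w.1 w.2‖ₑ ^ 3)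
      (volume.restrict (parabolicCylinder 1 (0 : ℝ × EuclideanSpace ℝ (Fin 3)))) := by
    have h1 : AEStronglyMeasurable (uncurry (r₀ • stPull (r₀ ^ 2) r₀ (T, z).1 (T, z).2 u))
        (volume.restrict (parabolicCylinder 1 (0 : ℝ × EuclideanSpace ℝ (Fin 3)))) :=
      hzoom.1.distributional.1.aestronglyMeasurable
    exact (h1.enorm.pow_const 3)
  have hsmall' : ∫⁻ w in parabolicCylinder 1 ((0 : ℝ), (0 : EuclideanSpace ℝ (Fin 3))),
      (‖(r₀ • stPull (r₀ ^ 2) r₀ (T, z).1 (T, z).2 u) w.1 w.2‖ₑ ^ 3 +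
        ‖(r₀ ^ 2 • stPull (r₀ ^ 2) r₀ (T, z).1 (T, z).2 p) w.1 w.2‖ₑ ^ (3 / 2 : ℝ)) <
      ENNReal.ofReal ε₀ := by
    have e : ((0 : ℝ), (0 : EuclideanSpace ℝ (Fin 3))) = (0 : ℝ × EuclideanSpace ℝ (Fin 3)) := rfl
    rw [e, lintegral_add_left' hmeasU, lintegral_cube_zoom hr₀ (T, z) u,
      lintegral_pressure_zoom hr₀ (T, z) p]
    exact hsmall
  obtain ⟨w, C, α, hα, hH, hae, -⟩ := H _ _ hzoom hsmall'
  -- the zoom of `v` agrees a.e. with `w` on `Q(0, 1/2)`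
  have hae_v : uncurry (r₀ • stPull (r₀ ^ 2) r₀ (T, z).1 (T, z).2 v)
      =ᵐ[volume.restrict (parabolicCylinder (1 / 2) (0 : ℝ × EuclideanSpace ℝ (Fin 3)))] w := by
    have h1 : uncurry u ∘ stAffine (r₀ ^ 2) r₀ (T, z).1 (T, z).2
        =ᵐ[volume.restrict (stAffine (r₀ ^ 2) r₀ (T, z).1 (T, z).2 ⁻¹' parabolicCylinder r₀ (T, z))]
        uncurry v ∘ stAffine (r₀ ^ 2) r₀ (T, z).1 (T, z).2 :=
      ae_eq_restrict_comp_stAffine (pow_pos hr₀ 2) hr₀ _ _ huv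
    rw [zoom_preimage_parabolicCylinder_self hr₀ (T, z)] at h1
    have h2 : uncurry (r₀ • stPull (r₀ ^ 2) r₀ (T, z).1 (T, z).2 u)
        =ᵐ[volume.restrict (parabolicCylinder 1 (0 : ℝ × EuclideanSpace ℝ (Fin 3)))]
        uncurry (r₀ • stPull (r₀ ^ 2) r₀ (T, z).1 (T, z).2 v) := by
      filter_upwards [h1] with q hq
      simp only [comp_apply, uncurry, stAffine_fst, stAffine_snd] at hq
      simp only [uncurry, smul_stPull_apply]
      rw [hq]
    have h12 : parabolicCylinder (1 / 2) (0 : ℝ × EuclideanSpace ℝ (Fin 3)) ⊆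
        parabolicCylinder 1 (0 : ℝ × EuclideanSpace ℝ (Fin 3)) :=
      parabolicCylinder_zero_mono (by norm_num) (by norm_num)
    exact Filter.EventuallyEq.trans
      (Filter.EventuallyEq.symm (ae_restrict_of_ae_restrict_of_subset h12 h2)) hae
  -- continuity of `v` on `Q((T, z), r₀/2)` and transport
  have hsub : parabolicCylinder (r₀ / 2) (T, z) ⊆ Ioo 0 T ×ˢ (univ : Set (EuclideanSpace ℝ (Fin 3))) := by
    intro q hq
    rw [mem_parabolicCylinder] at hq
    refine ⟨⟨?_, hq.1.2⟩, mem_univ _⟩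
    have h1 : T - (r₀ / 2) ^ 2 < q.1 := hq.1.1
    nlinarith
  have hcont : ContinuousOn (uncurry v) (parabolicCylinder (r₀ / 2) (T, z)) :=
    hv.smooth_velocity.continuousOn.mono hsub
  obtain ⟨C', hC'⟩ := holderOnWith_of_zoom_ae_eq hr₀ (T, z) hcont hα (hH.mono subset_closure) hae_v
  exact ⟨r₀ / 2, by positivity, C', α, hα, hC'⟩

end InBall

end Literature.Analysis.FluidPDE

end
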